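import Summits.AtomisticToContinuum.FouriersLaw.Theses.HonestZwanzig
import Summits.AtomisticToContinuum.FouriersLaw.Theorems.HonestZwanzigNetworkReductionLimits

/-!
# HonestZwanzig / PositiveMemory — the fixed-`N` upper limit (line `Sketch`, Stub U)

Support file for item `stmt-AtomisticToContinuum-12694` (`PositiveMemory` of route `HonestZwanzig`,
sub-problem `FouriersLaw`). At every fixed `N`, if the orthogonal-dynamics DC responses
`ρ_b = lim_{s↓0} schur_s(j_b, J)` exist on the genuine bonds `b + 1 < N` (and `ρ_{N−1} := 0` on the
phantom index), then `∫₀^∞ corr(J,J) ≤ Σ_b ρ_b`.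

* `upper_circuit`: the abstract fixed-`s` half of the circuit formula, over abstract pairings
  `lap, schur` and observables `e x`, `j b`, `J`: `lap(J,J) ≤ Σ_b schur(j_b, J)`, because
  `Σ_b schur(j_b,J) = schur(J,J) = lap(J,J) + aᵀG⁻¹a` with `a_x = lap(J,e_x) = −lap(e_x,J)` and `G`
  symmetric positive definite (steps (1)–(3) of `NetworkReduction.circuit_sandwich`, without the
  covariance / Robin hypotheses of its lower half).
* `fixedN_upperLimit`: the canonical instance (package lemmas `pkg_G_symm`, `pkg_rev`, `pkg_J_lap`,
  `pkg_j_last` of `FeshbachIdentities`) followed by `s ↓ 0` (`tendsto_lap_totalCurrent`,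
  `le_of_tendsto_of_tendsto`).
* `stub_upperLimit`: the registered stub of line `Sketch`, obtained by instantiating the gadgets
  by `rfl`.
-/

noncomputable section

open MeasureTheory Finset Real Set Filter Topology
open Literature.MathematicalPhysics.KineticTheory.HeatConduction
open Summit.AtomisticToContinuum.FouriersLaw.Theorems.HonestZwanzig.NetworkReduction

namespace Summit.AtomisticToContinuum.FouriersLaw.Theorems.HonestZwanzig.PositiveMemory

/-! ### The abstract fixed-`s` upper bound -/

section Circuit

open Matrix

variable {X : Type*} {N : ℕ}

/-- **The upper half of the circuit formula** (abstract pairings at one fixed `s`). If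
`G = [lap(e_x,e_y)]` is symmetric with positive quadratic form, `lap(e_x, J) = −lap(J, e_x)` (time
reversal) and `lap(J, ·) = Σ_b lap(j_b, ·)` against `J` and every `e_u`, then
`lap(J,J) ≤ Σ_b schur(j_b, J)`: indeed `Σ_b schur(j_b,J) = schur(J,J) = lap(J,J) + aᵀG⁻¹a` with
`a_x = lap(J,e_x)` and `aᵀG⁻¹a ≥ 0`. -/
theorem upper_circuit (lap schur : (X → ℝ) → (X → ℝ) → ℝ) (e j : Fin N → X → ℝ) (J : X → ℝ)
    (G : Matrix (Fin N) (Fin N) ℝ) (hG : ∀ x y, G x y = lap (e x) (e y))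
    (hschur : ∀ f g, schur f g = lap f g - ∑ x, ∑ y, lap f (e x) * G⁻¹ x y * lap (e y) g)
    (hGs : ∀ x y, lap (e x) (e y) = lap (e y) (e x))
    (hGp : ∀ v : Fin N → ℝ, v ≠ 0 → 0 < ∑ x, ∑ y, v x * G x y * v y)
    (hrev : ∀ x, lap (e x) J = -lap J (e x))
    (hJJ : lap J J = ∑ b, lap (j b) J) (hJe : ∀ u, lap J (e u) = ∑ b, lap (j b) (e u)) :
    lap J J ≤ ∑ b, schur (j b) J := by
  classical
  have hGsym : ∀ x y, G x y = G y x := fun x y => by rw [hG, hG, hGs]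
  have hGpd : G.PosDef := posDef_of_symm_of_pos G hGsym hGp
  -- the vector `a_x = lap(J, e_x)`
  set a : Fin N → ℝ := fun x => lap J (e x) with ha
  -- (1) schur(J,J) = lap(J,J) + aᵀ G⁻¹ a
  have h1 : schur J J = lap J J + a ⬝ᵥ (G⁻¹ *ᵥ a) := by
    rw [hschur, ← sum_sum_eq_dotProduct_mulVec]
    have : ∀ x y, lap J (e x) * G⁻¹ x y * lap (e y) J = -(a x * G⁻¹ x y * a y) := by
      intro x y
      rw [hrev, ha]
      ring
    simp_rw [this]
    simp only [Finset.sum_neg_distrib, sub_neg_eq_add]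
  -- (2) aᵀ G⁻¹ a ≥ 0
  have h2 : 0 ≤ a ⬝ᵥ (G⁻¹ *ᵥ a) := by
    have := hGpd.inv.posSemidef.dotProduct_mulVec_nonneg a
    rwa [star_trivial] at this
  -- (3) schur(J,J) = Σ_b schur(j_b, J)
  have h3 : schur J J = ∑ b, schur (j b) J := by
    have := schur_lincomb lap schur e J G hschur (fun _ => 1) 0 J J j
      (by rw [hJJ]; simp) (fun u => by rw [hJe]; simp)
    rw [this]
    simp
  rw [← h3, h1]
  linarith

end Circuit

/-! ### The fixed-`N` upper limit for the canonical objects -/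

section Package

variable {ω₂ lam β γ : ℝ} {N : ℕ} {T : ℝ}
  {Adm : (PhaseSpace N → ℝ) → Prop}
  {corr : (PhaseSpace N → ℝ) → (PhaseSpace N → ℝ) → ℝ → ℝ}
  {lap : ℝ → (PhaseSpace N → ℝ) → (PhaseSpace N → ℝ) → ℝ}
  {cov : (PhaseSpace N → ℝ) → (PhaseSpace N → ℝ) → ℝ}
  {e : Fin N → PhaseSpace N → ℝ}
  (hAdm : ∀ f, Adm f ↔ (Continuous f ∧ ∃ A : ℝ, ∀ z,
    |f z| ≤ A * Real.exp ((pinnedChain ω₂ lam β γ).hamiltonian N z / (8 * T))))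
  (hcorr : ∀ f g t, corr f g t =
    (∫ z, f z * (∫ y, g y ∂((pinnedChain ω₂ lam β γ).transitionKernel N T T t.toNNReal z))
      ∂(pinnedChain ω₂ lam β γ).gibbsMeasure N T) -
    (∫ z, f z ∂(pinnedChain ω₂ lam β γ).gibbsMeasure N T) *
      (∫ z, g z ∂(pinnedChain ω₂ lam β γ).gibbsMeasure N T))
  (hlap : ∀ s f g, lap s f g = ∫ t in Set.Ioi (0 : ℝ), Real.exp (-(s * t)) * corr f g t)
  (he : ∀ x z, e x z = z.2 x ^ 2 / 2 + (pinnedChain ω₂ lam β γ).U (z.1 x) +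
    ∑ j : Fin N, ((if j.val = x.val + 1 then (pinnedChain ω₂ lam β γ).V (z.1 j - z.1 x) / 2 else 0) +
      (if x.val = j.val + 1 then (pinnedChain ω₂ lam β γ).V (z.1 x - z.1 j) / 2 else 0)))
  (hFI : ∀ f g : PhaseSpace N → ℝ, Adm f → Adm g →
    Integrable f ((pinnedChain ω₂ lam β γ).gibbsMeasure N T) ∧
    (∀ t : ℝ, 0 ≤ t → Integrable (fun z => f z *
      (∫ y, g y ∂((pinnedChain ω₂ lam β γ).transitionKernel N T T t.toNNReal z)))
      ((pinnedChain ω₂ lam β γ).gibbsMeasure N T)) ∧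
    IntegrableOn (corr f g) (Set.Ioi 0) ∧
    (∀ t : ℝ, 0 ≤ t → corr f g t = corr (fun z => g (z.1, -z.2)) (fun z => f (z.1, -z.2)) t) ∧
    (∀ s : ℝ, 0 < s → ∀ x : Fin N,
      s * lap s (e x) g - cov (e x) g =
        lap s (fun z => (pinnedChain ω₂ lam β γ).generator N T T (e x) (z.1, -z.2)) g ∧
      s * lap s f (e x) - cov f (e x) = lap s f ((pinnedChain ω₂ lam β γ).generator N T T (e x))))
  (hω : 0 < ω₂) (hl : 0 ≤ lam) (hβ : 0 ≤ β) (hT : 0 < T)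

include hAdm hcorr hlap he hFI hω hl hβ hT in
/-- **The fixed-`N` upper limit.** Given the orthogonal-dynamics DC responses
`ρ_b = lim_{s↓0} schur_s(j_b, J)` on the genuine bonds `b + 1 < N` (and `ρ_b = 0` on the phantom
index) and positive definiteness of `G(s)` for `s > 0`: `∫₀^∞ corr(J,J) ≤ Σ_b ρ_b`. At each `s > 0`,
`lap_s(J,J) ≤ Σ_b schur_s(j_b, J)` (`upper_circuit` fed by the package lemmas); then `s ↓ 0`. -/
theorem fixedN_upperLimit
    (G : ℝ → Matrix (Fin N) (Fin N) ℝ) (hG : ∀ s x y, G s x y = lap s (e x) (e y))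
    (schur : ℝ → (PhaseSpace N → ℝ) → (PhaseSpace N → ℝ) → ℝ)
    (hschur : ∀ s f g, schur s f g = lap s f g - ∑ x, ∑ y, lap s f (e x) * (G s)⁻¹ x y * lap s (e y) g)
    (hGp : ∀ s : ℝ, 0 < s → ∀ v : Fin N → ℝ, v ≠ 0 → 0 < ∑ x, ∑ y, v x * G s x y * v y)
    (ρ : Fin N → ℝ)
    (hρ : ∀ b : Fin N, b.val + 1 < N → Tendsto (fun s => schur s ((pinnedChain ω₂ lam β γ).bondCurrent N b)
      (fun z => ∑ i : Fin N, (pinnedChain ω₂ lam β γ).bondCurrent N i z)) (nhdsWithin (0 : ℝ) (Set.Ioi 0))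
      (nhds (ρ b)))
    (hρ0 : ∀ b : Fin N, ¬ b.val + 1 < N → ρ b = 0) :
    ∫ t in Set.Ioi (0 : ℝ), corr (fun z => ∑ i : Fin N, (pinnedChain ω₂ lam β γ).bondCurrent N i z)
        (fun z => ∑ i : Fin N, (pinnedChain ω₂ lam β γ).bondCurrent N i z) t ≤ ∑ b, ρ b := by
  set J : PhaseSpace N → ℝ := fun z => ∑ i : Fin N, (pinnedChain ω₂ lam β γ).bondCurrent N i z with hJ
  set j : Fin N → PhaseSpace N → ℝ := (pinnedChain ω₂ lam β γ).bondCurrent N with hj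
  have hJa : Adm J := adm_totalCurrent Adm hAdm hω hl hβ hT
  have hex : ∀ x, Adm (e x) := fun x => adm_e Adm hAdm e he hω hl hβ hT x
  -- every bond response converges (the phantom last bond is identically zero)
  have hρ' : ∀ b : Fin N, Tendsto (fun s => schur s (j b) J) (nhdsWithin (0 : ℝ) (Set.Ioi 0))
      (nhds (ρ b)) := by
    intro b
    by_cases hb : b.val + 1 < N
    · exact hρ b hb
    · have h0 : ∀ s, schur s (j b) J = 0 := by
        intro s
        rw [hschur, pkg_j_last hcorr hlap s b hb, zero_sub, neg_eq_zero]
        refine Finset.sum_eq_zero fun x _ => Finset.sum_eq_zero fun y _ => ?_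
        rw [pkg_j_last hcorr hlap s b hb, zero_mul, zero_mul]
      rw [show (fun s => schur s (j b) J) = fun _ => 0 from funext h0, hρ0 b hb]
      exact tendsto_const_nhds
  -- the upper bound converges
  have hUB : Tendsto (fun s => ∑ b, schur s (j b) J) (nhdsWithin (0 : ℝ) (Set.Ioi 0))
      (nhds (∑ b, ρ b)) := tendsto_finsetSum _ fun b _ => hρ' b
  have hlapJJ := tendsto_lap_totalCurrent hAdm hlap hFI hω hl hβ hT (corr := corr)
  -- the fixed-`s` bound holds for every `0 < s`
  have hsand : ∀ᶠ s in nhdsWithin (0 : ℝ) (Set.Ioi 0), lap s J J ≤ ∑ b, schur s (j b) J := by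
    filter_upwards [self_mem_nhdsWithin] with s hs
    have hs1 : 0 < s := hs
    exact upper_circuit (lap s) (schur s) e j J (G s) (hG s) (hschur s)
      (pkg_G_symm hAdm hlap he hFI hω hl hβ hT s) (hGp s hs1)
      (pkg_rev hAdm hcorr hlap he hFI hω hl hβ hT s)
      (pkg_J_lap hAdm hcorr hlap hFI hω hl hβ hT hs1.le hJa)
      (fun u => pkg_J_lap hAdm hcorr hlap hFI hω hl hβ hT hs1.le (hex u))
  exact le_of_tendsto_of_tendsto hlapJJ hUB hsand

end Package

/-! ### The registered stub -/

/-- **Stub U — the fixed-`N` upper limit** (from the `FeshbachIdentities` package): at every `N ≥ 2`,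
if the orthogonal-dynamics DC responses `ρ_b = lim_{s↓0} schur_s(j_b, J)` exist on the genuine bonds
`b + 1 < N` (and `ρ_{N−1} := 0` on the phantom index), then `∫₀^∞ corr(J,J) ≤ Σ_b ρ_b`. At each
`s > 0`, `Σ_b schur_s(j_b,J) = schur_s(J,J) = lap_s(J,J) + aᵀG(s)⁻¹a ≥ lap_s(J,J)` with
`a_x = lap_s(J,e_x) = −lap_s(e_x,J)` (time reversal) and `G(s)` symmetric positive definite
(`FeshbachIdentities` (ii), (iv)); then `s ↓ 0` (`tendsto_lap_totalCurrent`,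
`le_of_tendsto_of_tendsto`). -/
theorem stub_upperLimit :
    Summit.AtomisticToContinuum.FouriersLaw.Theses.HonestZwanzig.FeshbachIdentities →
    ∀ ω₂ lam β γ : ℝ, 0 < ω₂ → 0 < lam → 0 < β → 0 < γ → ∀ T : ℝ, 0 < T → ∀ N : ℕ, 2 ≤ N →
    let P := Literature.MathematicalPhysics.KineticTheory.HeatConduction.pinnedChain ω₂ lam β γ;
    let X := Literature.MathematicalPhysics.KineticTheory.HeatConduction.PhaseSpace N;
    let μ : MeasureTheory.Measure X := P.gibbsMeasure N T;
    let corr : (X → ℝ) → (X → ℝ) → ℝ → ℝ := fun f g t =>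
      (∫ z, f z * (∫ y, g y ∂(P.transitionKernel N T T t.toNNReal z)) ∂μ) - (∫ z, f z ∂μ) * (∫ z, g z ∂μ);
    let lap : ℝ → (X → ℝ) → (X → ℝ) → ℝ := fun s f g =>
      ∫ t in Set.Ioi (0 : ℝ), Real.exp (-(s * t)) * corr f g t;
    let e : Fin N → X → ℝ := fun x z => z.2 x ^ 2 / 2 + P.U (z.1 x) +
      ∑ j : Fin N, ((if j.val = x.val + 1 then P.V (z.1 j - z.1 x) / 2 else 0) +
        (if x.val = j.val + 1 then P.V (z.1 x - z.1 j) / 2 else 0));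
    let G : ℝ → Matrix (Fin N) (Fin N) ℝ := fun s => Matrix.of fun x y => lap s (e x) (e y);
    let schur : ℝ → (X → ℝ) → (X → ℝ) → ℝ := fun s f g =>
      lap s f g - ∑ x : Fin N, ∑ y : Fin N, lap s f (e x) * (G s)⁻¹ x y * lap s (e y) g;
    let J : X → ℝ := fun z => ∑ i : Fin N, P.bondCurrent N i z;
    ∀ ρ : Fin N → ℝ,
      (∀ b : Fin N, b.val + 1 < N →
        Filter.Tendsto (fun s => schur s (P.bondCurrent N b) J) (nhdsWithin (0 : ℝ) (Set.Ioi 0)) (nhds (ρ b))) →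
      (∀ b : Fin N, ¬ b.val + 1 < N → ρ b = 0) →
      ∫ t in Set.Ioi (0 : ℝ), corr J J t ≤ ∑ b : Fin N, ρ b := by
  intro hFI ω₂ lam β γ hω hl hβ hγ T hT N hN
  obtain ⟨-, hFI2, -, hGpos⟩ := hFI ω₂ lam β γ hω hl hβ hγ T hT N hN
  intro P X μ corr lap e G schur J ρ hρ hρ0
  exact fixedN_upperLimit (ω₂ := ω₂) (lam := lam) (β := β) (γ := γ) (N := N) (T := T)
    (cov := fun f g => (∫ z, f z * g z ∂μ) - (∫ z, f z ∂μ) * (∫ z, g z ∂μ))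
    (fun f => Iff.rfl) (fun f g t => rfl) (fun s f g => rfl) (fun x z => rfl) hFI2
    hω hl.le hβ.le hT G (fun s x y => rfl) schur (fun s f g => rfl)
    (fun s hs v hv => hGpos s hs v hv) ρ hρ hρ0

end Summit.AtomisticToContinuum.FouriersLaw.Theorems.HonestZwanzig.PositiveMemory

end
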